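import Summits.Ventures.WeilGRH.CensusTwoPrimeRungs
import Mathlib.Analysis.SpecialFunctions.Trigonometric.Bounds
import HarnessLib

/-!
# GRH arm (rh-explicit, venture WeilGRH): the two-prime reflection rung `59/100` for NAMED census characters
  (part 2: the classes keyed by metric facts about `χ(2)`, `χ(3)`)

Cell `rh-explicit`, WEIL TRACK — GRH ARM (census / typing seat weil-grh-1; asked by weil-grh-2).  Sequel of
`CensusTwoPrimeRungs.lean`.  The remaining conductor-`17` and `-19` classes of weil-grh-2's
`TwoPrimeReflectionRungsClasses.lean`, with the hypotheses on `χ(2) = ζ_ord^{E[2]}`, `χ(3) = ζ_ord^{E[3]}`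
discharged by `‖1 − e^{iθ}‖² = 2 − 2cos θ` and elementary bounds on `cos` (`1 − x²/2 ≤ cos x`, `sin x ≤ x`,
`cos(π − x) = −cos x`, `cos(π/4) = √2/2`):

| class | `ord` | `E[2]`, `E[3]` | facts used | via |
|---|---|---|---|---|
| 17.2 / 17.9 | 8 | (2,7) / (6,1) | `χ(2) = ±i`; `‖1 − χ(3)‖² = 2 − √2 ≤ (4/5)²` | `…_chi_three_le'` |
| 17.3 / 17.6 | 16 | (·,1) / (·,15) | `‖1 − χ(3)‖² = 2 − 2cos(π/8) ≤ (2/5)²` | `…_chi_three_near_one` |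
| 17.10 / 17.12 | 16 | (10,3) / (6,13) | `cos(5π/4) = cos(3π/4) = −√2/2`, `cos(3π/8) ≥ 0` | `…_sq_le_two` |
| 19.6 / 19.16 | 9 | (7,1) / (2,8) | `cos(4π/9) = sin(π/18) ≤ π/18`, `cos(2π/9) ≥ 1 − (2π/9)²/2` | `…_chi_three_le` |
| 19.7 / 19.11 | 3 | (1,1) / (2,2) | nontrivial cube roots of unity | `…_cube_cube` |
| 19.8 / 19.12 | 6 | (1,1) / (5,5) | primitive sixth roots: `z³ = −1`, `z ≠ −1` | `…_sixth_sixth` |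
| 19.9 / 19.17 | 9 | (4,7) / (5,2) | `cos(8π/9) = cos(10π/9) = −cos(π/9) ≤ −1/2`, `cos(4π/9) ≥ 0` | `…_sq_le_two` |
| 19.14 / 19.15 | 18 | (7,1) / (11,17) | `cos(7π/9) = cos(11π/9) = −cos(2π/9) ≤ −1/2`, `cos(π/9) ≥ 0` | `…_sq_le_two` |

No new definitions; no named facts; RH/GRH-free.
-/

noncomputable section

open Complex
open scoped Real ComplexConjugate

namespace Summit.Ventures.WeilGRH

open Literature.NumberTheory.LFunctions

/-! ## Elementary trigonometric facts -/

/-- `(2 : ZMod q)` is the cast of the natural number `2`. -/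
private theorem two_eq_natCast' (q : ℕ) : (2 : ZMod q) = ((2 : ℕ) : ZMod q) := by norm_cast

/-- `(3 : ZMod q)` is the cast of the natural number `3`. -/
private theorem three_eq_natCast' (q : ℕ) : (3 : ZMod q) = ((3 : ℕ) : ZMod q) := by norm_cast

/-- `1.36 < √2`. -/
private theorem sqrt_two_gt : (1.36 : ℝ) < Real.sqrt 2 := (Real.lt_sqrt (by norm_num)).2 (by norm_num)

/-- `cos(2π/9) ≥ 0.755` (`1 − x²/2 ≤ cos x`, `π < 3.15`). -/
theorem cos_two_pi_div_nine_ge : (0.755 : ℝ) ≤ Real.cos (2 * π / 9) := by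
  have h := Real.one_sub_sq_div_two_le_cos (x := 2 * π / 9)
  nlinarith [Real.pi_lt_d2, Real.pi_gt_three]

/-- `cos(π/9) ≥ 0.93`. -/
theorem cos_pi_div_nine_ge : (0.93 : ℝ) ≤ Real.cos (π / 9) := by
  have h := Real.one_sub_sq_div_two_le_cos (x := π / 9)
  nlinarith [Real.pi_lt_d2, Real.pi_gt_three]

/-- `cos(π/8) ≥ 0.92`. -/
theorem cos_pi_div_eight_ge : (0.92 : ℝ) ≤ Real.cos (π / 8) := by
  have h := Real.one_sub_sq_div_two_le_cos (x := π / 8)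
  nlinarith [Real.pi_lt_d2, Real.pi_gt_three]

/-- `0 ≤ cos(4π/9) ≤ 0.18` (`cos(4π/9) = sin(π/18) ≤ π/18`). -/
theorem cos_four_pi_div_nine_bounds : 0 ≤ Real.cos (4 * π / 9) ∧ Real.cos (4 * π / 9) ≤ 0.18 := by
  have h1 : Real.cos (4 * π / 9) = Real.sin (π / 18) := by
    rw [← Real.cos_pi_div_two_sub]; congr 1; ring
  rw [h1]
  refine ⟨Real.sin_nonneg_of_nonneg_of_le_pi (by positivity) (by linarith [Real.pi_pos]), ?_⟩
  have h2 := Real.sin_le (show (0 : ℝ) ≤ π / 18 by positivity)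
  linarith [Real.pi_lt_d2]

/-- `0 ≤ cos(3π/8)`, `0 ≤ cos(π/9)`, `0 ≤ cos(2π/9)`: angles in `[0, π/2]`. -/
theorem cos_nonneg_small {x : ℝ} (h0 : 0 ≤ x) (h1 : x ≤ π / 2) : 0 ≤ Real.cos x :=
  Real.cos_nonneg_of_neg_pi_div_two_le_of_le (by linarith [Real.pi_pos]) h1

/-! ## Values of `χ(k) = ζ^{E[k]}` as `e^{iθ}` and their distances to `1` -/

/-- The value `χ(k)` of a census character as `e^{iθ}`, `θ = 2πE[k]/ord` (units `k`). -/
theorem censusRow_toChar_natCast {q n : ℕ} (h : (censusRow q n).check = true) (k : ℕ)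
    (hk : Nat.Coprime k (censusRow q n).q) :
    (censusRow q n).toChar h (k : ZMod (censusRow q n).q) =
      cexp (((2 * π * (censusRow q n).e k / (censusRow q n).ord : ℝ) : ℂ) * I) := by
  rw [ConreyRow.toChar_apply_natCast, if_pos hk, ConreyRow.zeta_pow_eq_cexp]

/-! ## 17.2 / 17.9 -/

/-- `‖1 − e^{i·7π/4}‖² = ‖1 − e^{i·π/4}‖² = 2 − √2 ≤ (4/5)²`. -/
private theorem normSq_one_sub_cexp_pi_div_four_le (θ : ℝ) (hθ : Real.cos θ = Real.sqrt 2 / 2) :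
    ‖1 - cexp ((θ : ℂ) * I)‖ ≤ 4 / 5 := by
  have hsq : ‖1 - cexp ((θ : ℂ) * I)‖ ^ 2 ≤ (4 / 5) ^ 2 := by
    rw [normSq_one_sub_cexp_mul_I, hθ]; nlinarith [sqrt_two_gt]
  have h0 := norm_nonneg (1 - cexp ((θ : ℂ) * I))
  nlinarith [hsq, h0]

/-- **Cell 17.2 at `59/100`** (`χ(2) = i`, `χ(3) = e^{7πi/4}`). -/
theorem weilPositivityOnChar_fiftynine_census_17_2 :
    WeilPositivityOnChar ((censusRow 17 2).toChar (census20_check _ (by decide))) (59 / 100) := by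
  refine weilPositivityOnChar_fiftynine_of_chi_three_le' (by decide) _ ?_ ?_
  · rw [two_eq_natCast', censusRow_toChar_natCast _ 2 (by decide), show (censusRow 17 2).e 2 = 2 by decide,
      show (censusRow 17 2).ord = 8 by decide, show (2 * π * ((2 : ℕ) : ℝ) / ((8 : ℕ) : ℝ) : ℝ) = π / 2 by
        push_cast; ring, normSq_one_sub_cexp_pi_div_two]
  · rw [three_eq_natCast', censusRow_toChar_natCast _ 3 (by decide), show (censusRow 17 2).e 3 = 7 by decide,
      show (censusRow 17 2).ord = 8 by decide]
    refine normSq_one_sub_cexp_pi_div_four_le _ ?_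
    rw [show (2 * π * ((7 : ℕ) : ℝ) / ((8 : ℕ) : ℝ) : ℝ) = -(π / 4) + 2 * π by push_cast; ring,
      Real.cos_add_two_pi, Real.cos_neg, Real.cos_pi_div_four]

/-- **Cell 17.9 at `59/100`** (`χ(2) = −i`, `χ(3) = e^{πi/4}`). -/
theorem weilPositivityOnChar_fiftynine_census_17_9 :
    WeilPositivityOnChar ((censusRow 17 9).toChar (census20_check _ (by decide))) (59 / 100) := by
  refine weilPositivityOnChar_fiftynine_of_chi_three_le' (by decide) _ ?_ ?_
  · rw [two_eq_natCast', censusRow_toChar_natCast _ 2 (by decide), show (censusRow 17 9).e 2 = 6 by decide,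
      show (censusRow 17 9).ord = 8 by decide, show (2 * π * ((6 : ℕ) : ℝ) / ((8 : ℕ) : ℝ) : ℝ) = 3 * π / 2 by
        push_cast; ring, normSq_one_sub_cexp_three_pi_div_two]
  · rw [three_eq_natCast', censusRow_toChar_natCast _ 3 (by decide), show (censusRow 17 9).e 3 = 1 by decide,
      show (censusRow 17 9).ord = 8 by decide]
    refine normSq_one_sub_cexp_pi_div_four_le _ ?_
    rw [show (2 * π * ((1 : ℕ) : ℝ) / ((8 : ℕ) : ℝ) : ℝ) = π / 4 by push_cast; ring, Real.cos_pi_div_four]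

/-! ## 17.3 / 17.6 -/

/-- `‖1 − e^{iθ}‖ ≤ 2/5` when `cos θ = cos(π/8)`. -/
private theorem norm_one_sub_cexp_le_two_fifths (θ : ℝ) (hθ : Real.cos θ = Real.cos (π / 8)) :
    ‖1 - cexp ((θ : ℂ) * I)‖ ≤ 2 / 5 := by
  have hsq : ‖1 - cexp ((θ : ℂ) * I)‖ ^ 2 ≤ (2 / 5) ^ 2 := by
    rw [normSq_one_sub_cexp_mul_I, hθ]; nlinarith [cos_pi_div_eight_ge]
  have h0 := norm_nonneg (1 - cexp ((θ : ℂ) * I))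
  nlinarith [hsq, h0]

/-- **Cell 17.3 at `59/100`** (`χ(3) = e^{πi/8}`). -/
theorem weilPositivityOnChar_fiftynine_census_17_3 :
    WeilPositivityOnChar ((censusRow 17 3).toChar (census20_check _ (by decide))) (59 / 100) := by
  refine weilPositivityOnChar_fiftynine_of_chi_three_near_one (by decide) _ ?_
  rw [three_eq_natCast', censusRow_toChar_natCast _ 3 (by decide), show (censusRow 17 3).e 3 = 1 by decide,
    show (censusRow 17 3).ord = 16 by decide]
  refine norm_one_sub_cexp_le_two_fifths _ ?_
  rw [show (2 * π * ((1 : ℕ) : ℝ) / ((16 : ℕ) : ℝ) : ℝ) = π / 8 by push_cast; ring]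

/-- **Cell 17.6 at `59/100`** (`χ(3) = e^{15πi/8}`). -/
theorem weilPositivityOnChar_fiftynine_census_17_6 :
    WeilPositivityOnChar ((censusRow 17 6).toChar (census20_check _ (by decide))) (59 / 100) := by
  refine weilPositivityOnChar_fiftynine_of_chi_three_near_one (by decide) _ ?_
  rw [three_eq_natCast', censusRow_toChar_natCast _ 3 (by decide), show (censusRow 17 6).e 3 = 15 by decide,
    show (censusRow 17 6).ord = 16 by decide]
  refine norm_one_sub_cexp_le_two_fifths _ ?_
  rw [show (2 * π * ((15 : ℕ) : ℝ) / ((16 : ℕ) : ℝ) : ℝ) = -(π / 8) + 2 * π by push_cast; ring,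
    Real.cos_add_two_pi, Real.cos_neg]

/-! ## 17.10 / 17.12 -/

/-- **Cell 17.10 at `59/100`** (`χ(2) = e^{5πi/4}`, `χ(3) = e^{3πi/8}`). -/
theorem weilPositivityOnChar_fiftynine_census_17_10 :
    WeilPositivityOnChar ((censusRow 17 10).toChar (census20_check _ (by decide))) (59 / 100) := by
  refine weilPositivityOnChar_fiftynine_of_sq_le_two (by decide) _ ?_ ?_
  · rw [two_eq_natCast', censusRow_toChar_natCast _ 2 (by decide), show (censusRow 17 10).e 2 = 10 by decide,
      show (censusRow 17 10).ord = 16 by decide, normSq_one_sub_cexp_mul_I,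
      show (2 * π * ((10 : ℕ) : ℝ) / ((16 : ℕ) : ℝ) : ℝ) = π / 4 + π by push_cast; ring, Real.cos_add_pi,
      Real.cos_pi_div_four]
    nlinarith [sqrt_two_gt]
  · rw [three_eq_natCast', censusRow_toChar_natCast _ 3 (by decide), show (censusRow 17 10).e 3 = 3 by decide,
      show (censusRow 17 10).ord = 16 by decide, normSq_one_sub_cexp_mul_I,
      show (2 * π * ((3 : ℕ) : ℝ) / ((16 : ℕ) : ℝ) : ℝ) = 3 * π / 8 by push_cast; ring]
    linarith [cos_nonneg_small (x := 3 * π / 8) (by positivity) (by linarith [Real.pi_pos])]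

/-- **Cell 17.12 at `59/100`** (`χ(2) = e^{3πi/4}`, `χ(3) = e^{13πi/8}`). -/
theorem weilPositivityOnChar_fiftynine_census_17_12 :
    WeilPositivityOnChar ((censusRow 17 12).toChar (census20_check _ (by decide))) (59 / 100) := by
  refine weilPositivityOnChar_fiftynine_of_sq_le_two (by decide) _ ?_ ?_
  · rw [two_eq_natCast', censusRow_toChar_natCast _ 2 (by decide), show (censusRow 17 12).e 2 = 6 by decide,
      show (censusRow 17 12).ord = 16 by decide, normSq_one_sub_cexp_mul_I,
      show (2 * π * ((6 : ℕ) : ℝ) / ((16 : ℕ) : ℝ) : ℝ) = π - π / 4 by push_cast; ring, Real.cos_pi_sub,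
      Real.cos_pi_div_four]
    nlinarith [sqrt_two_gt]
  · rw [three_eq_natCast', censusRow_toChar_natCast _ 3 (by decide), show (censusRow 17 12).e 3 = 13 by decide,
      show (censusRow 17 12).ord = 16 by decide, normSq_one_sub_cexp_mul_I,
      show (2 * π * ((13 : ℕ) : ℝ) / ((16 : ℕ) : ℝ) : ℝ) = -(3 * π / 8) + 2 * π by push_cast; ring,
      Real.cos_add_two_pi, Real.cos_neg]
    linarith [cos_nonneg_small (x := 3 * π / 8) (by positivity) (by linarith [Real.pi_pos])]

/-! ## 19.6 / 19.16 -/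

/-- `‖1 − e^{iθ}‖ ≤ 7/10` when `cos θ = cos(2π/9)`. -/
private theorem norm_one_sub_cexp_le_seven_tenths (θ : ℝ) (hθ : Real.cos θ = Real.cos (2 * π / 9)) :
    ‖1 - cexp ((θ : ℂ) * I)‖ ≤ 7 / 10 := by
  have hsq : ‖1 - cexp ((θ : ℂ) * I)‖ ^ 2 ≤ (7 / 10) ^ 2 := by
    rw [normSq_one_sub_cexp_mul_I, hθ]; nlinarith [cos_two_pi_div_nine_ge]
  have h0 := norm_nonneg (1 - cexp ((θ : ℂ) * I))
  nlinarith [hsq, h0]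

/-- **Cell 19.6 at `59/100`** (`χ(2) = e^{14πi/9}`, `χ(3) = e^{2πi/9}`). -/
theorem weilPositivityOnChar_fiftynine_census_19_6 :
    WeilPositivityOnChar ((censusRow 19 6).toChar (census20_check _ (by decide))) (59 / 100) := by
  refine weilPositivityOnChar_fiftynine_of_chi_three_le (by decide) _ ?_ ?_
  · rw [two_eq_natCast', censusRow_toChar_natCast _ 2 (by decide), show (censusRow 19 6).e 2 = 7 by decide,
      show (censusRow 19 6).ord = 9 by decide, normSq_one_sub_cexp_mul_I,
      show (2 * π * ((7 : ℕ) : ℝ) / ((9 : ℕ) : ℝ) : ℝ) = -(4 * π / 9) + 2 * π by push_cast; ring,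
      Real.cos_add_two_pi, Real.cos_neg]
    linarith [cos_four_pi_div_nine_bounds.2]
  · rw [three_eq_natCast', censusRow_toChar_natCast _ 3 (by decide), show (censusRow 19 6).e 3 = 1 by decide,
      show (censusRow 19 6).ord = 9 by decide]
    refine norm_one_sub_cexp_le_seven_tenths _ ?_
    rw [show (2 * π * ((1 : ℕ) : ℝ) / ((9 : ℕ) : ℝ) : ℝ) = 2 * π / 9 by push_cast; ring]

/-- **Cell 19.16 at `59/100`** (`χ(2) = e^{4πi/9}`, `χ(3) = e^{16πi/9}`). -/
theorem weilPositivityOnChar_fiftynine_census_19_16 :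
    WeilPositivityOnChar ((censusRow 19 16).toChar (census20_check _ (by decide))) (59 / 100) := by
  refine weilPositivityOnChar_fiftynine_of_chi_three_le (by decide) _ ?_ ?_
  · rw [two_eq_natCast', censusRow_toChar_natCast _ 2 (by decide), show (censusRow 19 16).e 2 = 2 by decide,
      show (censusRow 19 16).ord = 9 by decide, normSq_one_sub_cexp_mul_I,
      show (2 * π * ((2 : ℕ) : ℝ) / ((9 : ℕ) : ℝ) : ℝ) = 4 * π / 9 by push_cast; ring]
    linarith [cos_four_pi_div_nine_bounds.2]
  · rw [three_eq_natCast', censusRow_toChar_natCast _ 3 (by decide), show (censusRow 19 16).e 3 = 8 by decide,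
      show (censusRow 19 16).ord = 9 by decide]
    refine norm_one_sub_cexp_le_seven_tenths _ ?_
    rw [show (2 * π * ((8 : ℕ) : ℝ) / ((9 : ℕ) : ℝ) : ℝ) = -(2 * π / 9) + 2 * π by push_cast; ring,
      Real.cos_add_two_pi, Real.cos_neg]

/-! ## 19.9 / 19.17 / 19.14 / 19.15 (`‖1 − χ(2)‖² ≥ 3`, `‖1 − χ(3)‖² ≤ 2`) -/

/-- **Cell 19.9 at `59/100`** (`χ(2) = e^{8πi/9}`, `χ(3) = e^{14πi/9}`). -/
theorem weilPositivityOnChar_fiftynine_census_19_9 :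
    WeilPositivityOnChar ((censusRow 19 9).toChar (census20_check _ (by decide))) (59 / 100) := by
  refine weilPositivityOnChar_fiftynine_of_sq_le_two (by decide) _ ?_ ?_
  · rw [two_eq_natCast', censusRow_toChar_natCast _ 2 (by decide), show (censusRow 19 9).e 2 = 4 by decide,
      show (censusRow 19 9).ord = 9 by decide, normSq_one_sub_cexp_mul_I,
      show (2 * π * ((4 : ℕ) : ℝ) / ((9 : ℕ) : ℝ) : ℝ) = π - π / 9 by push_cast; ring, Real.cos_pi_sub]
    linarith [cos_pi_div_nine_ge]
  · rw [three_eq_natCast', censusRow_toChar_natCast _ 3 (by decide), show (censusRow 19 9).e 3 = 7 by decide,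
      show (censusRow 19 9).ord = 9 by decide, normSq_one_sub_cexp_mul_I,
      show (2 * π * ((7 : ℕ) : ℝ) / ((9 : ℕ) : ℝ) : ℝ) = -(4 * π / 9) + 2 * π by push_cast; ring,
      Real.cos_add_two_pi, Real.cos_neg]
    linarith [cos_four_pi_div_nine_bounds.1]

/-- **Cell 19.17 at `59/100`** (`χ(2) = e^{10πi/9}`, `χ(3) = e^{4πi/9}`). -/
theorem weilPositivityOnChar_fiftynine_census_19_17 :
    WeilPositivityOnChar ((censusRow 19 17).toChar (census20_check _ (by decide))) (59 / 100) := by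
  refine weilPositivityOnChar_fiftynine_of_sq_le_two (by decide) _ ?_ ?_
  · rw [two_eq_natCast', censusRow_toChar_natCast _ 2 (by decide), show (censusRow 19 17).e 2 = 5 by decide,
      show (censusRow 19 17).ord = 9 by decide, normSq_one_sub_cexp_mul_I,
      show (2 * π * ((5 : ℕ) : ℝ) / ((9 : ℕ) : ℝ) : ℝ) = π / 9 + π by push_cast; ring, Real.cos_add_pi]
    linarith [cos_pi_div_nine_ge]
  · rw [three_eq_natCast', censusRow_toChar_natCast _ 3 (by decide), show (censusRow 19 17).e 3 = 2 by decide,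
      show (censusRow 19 17).ord = 9 by decide, normSq_one_sub_cexp_mul_I,
      show (2 * π * ((2 : ℕ) : ℝ) / ((9 : ℕ) : ℝ) : ℝ) = 4 * π / 9 by push_cast; ring]
    linarith [cos_four_pi_div_nine_bounds.1]

/-- **Cell 19.14 at `59/100`** (`χ(2) = e^{7πi/9}`, `χ(3) = e^{πi/9}`). -/
theorem weilPositivityOnChar_fiftynine_census_19_14 :
    WeilPositivityOnChar ((censusRow 19 14).toChar (census20_check _ (by decide))) (59 / 100) := by
  refine weilPositivityOnChar_fiftynine_of_sq_le_two (by decide) _ ?_ ?_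
  · rw [two_eq_natCast', censusRow_toChar_natCast _ 2 (by decide), show (censusRow 19 14).e 2 = 7 by decide,
      show (censusRow 19 14).ord = 18 by decide, normSq_one_sub_cexp_mul_I,
      show (2 * π * ((7 : ℕ) : ℝ) / ((18 : ℕ) : ℝ) : ℝ) = π - 2 * π / 9 by push_cast; ring, Real.cos_pi_sub]
    linarith [cos_two_pi_div_nine_ge]
  · rw [three_eq_natCast', censusRow_toChar_natCast _ 3 (by decide), show (censusRow 19 14).e 3 = 1 by decide,
      show (censusRow 19 14).ord = 18 by decide, normSq_one_sub_cexp_mul_I,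
      show (2 * π * ((1 : ℕ) : ℝ) / ((18 : ℕ) : ℝ) : ℝ) = π / 9 by push_cast; ring]
    linarith [cos_nonneg_small (x := π / 9) (by positivity) (by linarith [Real.pi_pos])]

/-- **Cell 19.15 at `59/100`** (`χ(2) = e^{11πi/9}`, `χ(3) = e^{17πi/9}`). -/
theorem weilPositivityOnChar_fiftynine_census_19_15 :
    WeilPositivityOnChar ((censusRow 19 15).toChar (census20_check _ (by decide))) (59 / 100) := by
  refine weilPositivityOnChar_fiftynine_of_sq_le_two (by decide) _ ?_ ?_
  · rw [two_eq_natCast', censusRow_toChar_natCast _ 2 (by decide), show (censusRow 19 15).e 2 = 11 by decide,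
      show (censusRow 19 15).ord = 18 by decide, normSq_one_sub_cexp_mul_I,
      show (2 * π * ((11 : ℕ) : ℝ) / ((18 : ℕ) : ℝ) : ℝ) = 2 * π / 9 + π by push_cast; ring, Real.cos_add_pi]
    linarith [cos_two_pi_div_nine_ge]
  · rw [three_eq_natCast', censusRow_toChar_natCast _ 3 (by decide), show (censusRow 19 15).e 3 = 17 by decide,
      show (censusRow 19 15).ord = 18 by decide, normSq_one_sub_cexp_mul_I,
      show (2 * π * ((17 : ℕ) : ℝ) / ((18 : ℕ) : ℝ) : ℝ) = -(π / 9) + 2 * π by push_cast; ring,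
      Real.cos_add_two_pi, Real.cos_neg]
    linarith [cos_nonneg_small (x := π / 9) (by positivity) (by linarith [Real.pi_pos])]

/-! ## 19.7 / 19.11 (cube roots) and 19.8 / 19.12 (sixth roots) -/

/-- A census character's `ζ` is a primitive `ord`-th root of unity. -/
private theorem censusRow_zeta_prim (q n : ℕ) (h : (censusRow q n).checkShape = true) :
    IsPrimitiveRoot (censusRow q n).zeta (censusRow q n).ord := ConreyRow.isPrimitiveRoot_zeta h

/-- **Cell 19.7 at `59/100`** (`χ(2) = χ(3) = ζ₃`). -/
theorem weilPositivityOnChar_fiftynine_census_19_7 :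
    WeilPositivityOnChar ((censusRow 19 7).toChar (census20_check _ (by decide))) (59 / 100) := by
  have hprim := censusRow_zeta_prim 19 7 (by decide)
  rw [show (censusRow 19 7).ord = 3 by decide] at hprim
  have hv : ∀ k : ℕ, (k = 2 ∨ k = 3) → (censusRow 19 7).toChar (census20_check _ (by decide)) (k : ZMod _) =
      (censusRow 19 7).zeta ^ 1 := by
    rintro k (rfl | rfl)
    · rw [ConreyRow.toChar_apply_natCast, if_pos (by decide), show (censusRow 19 7).e 2 = 1 by decide]
    · rw [ConreyRow.toChar_apply_natCast, if_pos (by decide), show (censusRow 19 7).e 3 = 1 by decide]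
  have hcube : ((censusRow 19 7).zeta ^ 1) ^ 3 = 1 := by rw [pow_one, hprim.pow_eq_one]
  have hne : (censusRow 19 7).zeta ^ 1 ≠ 1 := hprim.pow_ne_one_of_pos_of_lt (by norm_num) (by norm_num)
  refine weilPositivityOnChar_fiftynine_of_cube_cube (by decide) _ ?_ ?_ ?_ ?_
  · rw [two_eq_natCast', hv 2 (Or.inl rfl)]; exact hcube
  · rw [two_eq_natCast', hv 2 (Or.inl rfl)]; exact hne
  · rw [three_eq_natCast', hv 3 (Or.inr rfl)]; exact hcube
  · rw [three_eq_natCast', hv 3 (Or.inr rfl)]; exact hne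

/-- **Cell 19.11 at `59/100`** (`χ(2) = χ(3) = ζ₃²`). -/
theorem weilPositivityOnChar_fiftynine_census_19_11 :
    WeilPositivityOnChar ((censusRow 19 11).toChar (census20_check _ (by decide))) (59 / 100) := by
  have hprim := censusRow_zeta_prim 19 11 (by decide)
  rw [show (censusRow 19 11).ord = 3 by decide] at hprim
  have hv : ∀ k : ℕ, (k = 2 ∨ k = 3) → (censusRow 19 11).toChar (census20_check _ (by decide)) (k : ZMod _) =
      (censusRow 19 11).zeta ^ 2 := by
    rintro k (rfl | rfl)
    · rw [ConreyRow.toChar_apply_natCast, if_pos (by decide), show (censusRow 19 11).e 2 = 2 by decide]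
    · rw [ConreyRow.toChar_apply_natCast, if_pos (by decide), show (censusRow 19 11).e 3 = 2 by decide]
  have hcube : ((censusRow 19 11).zeta ^ 2) ^ 3 = 1 := by
    rw [← pow_mul, show 2 * 3 = 3 * 2 by norm_num, pow_mul, hprim.pow_eq_one, one_pow]
  have hne : (censusRow 19 11).zeta ^ 2 ≠ 1 := hprim.pow_ne_one_of_pos_of_lt (by norm_num) (by norm_num)
  refine weilPositivityOnChar_fiftynine_of_cube_cube (by decide) _ ?_ ?_ ?_ ?_
  · rw [two_eq_natCast', hv 2 (Or.inl rfl)]; exact hcube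
  · rw [two_eq_natCast', hv 2 (Or.inl rfl)]; exact hne
  · rw [three_eq_natCast', hv 3 (Or.inr rfl)]; exact hcube
  · rw [three_eq_natCast', hv 3 (Or.inr rfl)]; exact hne

/-- For a primitive sixth root of unity `ζ` and `e ∈ {1, 5}`: `(ζ^e)² − ζ^e + 1 = 0`
(`(ζ^e)³ = ζ³ = −1`, `(z + 1)(z² − z + 1) = z³ + 1 = 0` and `z ≠ −1 = ζ³`). -/
private theorem sixth_root_quadratic {ζ : ℂ} (h : IsPrimitiveRoot ζ 6) {e : ℕ} (he : e = 1 ∨ e = 5) :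
    (ζ ^ e) ^ 2 - ζ ^ e + 1 = 0 := by
  have h6 : ζ ^ 6 = 1 := h.pow_eq_one
  have h3 : ζ ^ 3 = -1 := by
    have hsq : (ζ ^ 3 + 1) * (ζ ^ 3 - 1) = 0 := by
      rw [show (ζ ^ 3 + 1) * (ζ ^ 3 - 1) = ζ ^ 6 - 1 by ring, h6, sub_self]
    have hne : ζ ^ 3 ≠ 1 := h.pow_ne_one_of_pos_of_lt (by norm_num) (by norm_num)
    rcases mul_eq_zero.1 hsq with h1 | h1
    · exact eq_neg_of_add_eq_zero_left h1
    · exact absurd (sub_eq_zero.1 h1) hne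
  have hz3 : (ζ ^ e) ^ 3 = -1 := by
    rcases he with rfl | rfl
    · rw [pow_one]; exact h3
    · rw [← pow_mul, show 5 * 3 = 6 * 2 + 3 by norm_num, pow_add, pow_mul, h6, one_pow, one_mul, h3]
  have hz : ζ ^ e ≠ -1 := by
    rw [← h3]
    intro hEq
    have hi : e < 6 := by rcases he with rfl | rfl <;> norm_num
    have := h.pow_inj hi (by norm_num) hEq
    rcases he with rfl | rfl <;> omega
  have hfac : (ζ ^ e + 1) * ((ζ ^ e) ^ 2 - ζ ^ e + 1) = 0 := by
    rw [show (ζ ^ e + 1) * ((ζ ^ e) ^ 2 - ζ ^ e + 1) = (ζ ^ e) ^ 3 + 1 by ring, hz3, neg_add_cancel]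
  rcases mul_eq_zero.1 hfac with h1 | h1
  · exact absurd (eq_neg_of_add_eq_zero_left h1) hz
  · exact h1

/-- **Cell 19.8 at `59/100`** (`χ(2) = χ(3) = ζ₆`). -/
theorem weilPositivityOnChar_fiftynine_census_19_8 :
    WeilPositivityOnChar ((censusRow 19 8).toChar (census20_check _ (by decide))) (59 / 100) := by
  have hprim := censusRow_zeta_prim 19 8 (by decide)
  rw [show (censusRow 19 8).ord = 6 by decide] at hprim
  refine weilPositivityOnChar_fiftynine_of_sixth_sixth (by decide) _ ?_ ?_
  · rw [two_eq_natCast', ConreyRow.toChar_apply_natCast, if_pos (by decide),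
      show (censusRow 19 8).e 2 = 1 by decide]
    exact sixth_root_quadratic hprim (Or.inl rfl)
  · rw [three_eq_natCast', ConreyRow.toChar_apply_natCast, if_pos (by decide),
      show (censusRow 19 8).e 3 = 1 by decide]
    exact sixth_root_quadratic hprim (Or.inl rfl)

/-- **Cell 19.12 at `59/100`** (`χ(2) = χ(3) = ζ₆⁵`). -/
theorem weilPositivityOnChar_fiftynine_census_19_12 :
    WeilPositivityOnChar ((censusRow 19 12).toChar (census20_check _ (by decide))) (59 / 100) := by
  have hprim := censusRow_zeta_prim 19 12 (by decide)
  rw [show (censusRow 19 12).ord = 6 by decide] at hprim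
  refine weilPositivityOnChar_fiftynine_of_sixth_sixth (by decide) _ ?_ ?_
  · rw [two_eq_natCast', ConreyRow.toChar_apply_natCast, if_pos (by decide),
      show (censusRow 19 12).e 2 = 5 by decide]
    exact sixth_root_quadratic hprim (Or.inr rfl)
  · rw [three_eq_natCast', ConreyRow.toChar_apply_natCast, if_pos (by decide),
      show (censusRow 19 12).e 3 = 5 by decide]
    exact sixth_root_quadratic hprim (Or.inr rfl)

end Summit.Ventures.WeilGRH

end
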